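import Summits.Ventures.DiscreteObjects.Hadamard.ConferenceGraph333

/-!
# The 3-adic obstruction to `C² = c·I`: no symmetric integer matrix of order `n ≡ 2 (mod 4)` squares to `c·I`
# with `3 ∥ c`; hence no symmetric conference matrix of order `22, 34, 58, 70, …` and no conference graph on
# `21, 33, 57, 69, …` vertices (kernel)

Framing: lottery ticket; floor = certified bounds/negative ranges.  Cell pub-namedobj (venture DiscreteObjects),
target (H) = `H(668)`, hadamard gen 30.  TOOL for the automorphism census of `srg(333,166,82,83)` ⇔ symmetric
`C(334)` (⇒ `H(668)`): gen 30 shows that an automorphism of order `13` would have as fixed-point subgraph a conference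
graph `srg(21,10,4,5)`; this file shows that no such graph exists, by an elementary finite-field argument that stays
inside Mathlib's linear algebra (no Hasse–Minkowski, no Witt cancellation).
* **`no_symm_mul_self_eq_smul_three`** — if `C : Matrix ι ι ℤ` is symmetric with `C * C = c • 1`, `3 ∣ c`, `9 ∤ c`,
  then `|ι| % 4 ≠ 2`.  Proof: over `𝔽₃`, `C̄² = 0`, so `im C̄ ⊆ ker C̄`; conversely `C̄ v̄ = 0` lifts to `C v = 3w`,
  `3·Cw = C²v = c v`, `Cw = (c/3) v` with `c/3` a unit mod `3`, so `ker C̄ = im C̄` and `rank C̄ = |ι|/2 =: m`.  The column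
  space `W` is totally isotropic for the dot product (`(C̄a)·(C̄a') = a·C̄²a' = 0`) of dimension `m`.  Extending a basis of
  `W` by a basis of a complement gives an invertible `P` whose Gram matrix `PᵀP = [[0, Y], [Yᵀ, Z]]` has determinant
  `(-1)^m det(Y)²` (`det_fromBlocks_zero₁₁_sq`); for `m` odd this is `−det(Y)² ∈ {0, 2}` in `𝔽₃`, while `det(P)² = 1`.
  (`no_lagrangian_odd_zmod3`: `𝔽₃^{2m}` with the standard form has no totally isotropic subspace of dimension `m` when
  `m` is odd — the discriminant `(−1)^m` of a hyperbolic space; equivalently: self-dual ternary codes have length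
  `≡ 0 (mod 4)`.)
* **`no_symm_conference_three`** — no symmetric conference matrix (`0` diagonal is not even needed: any symmetric `C`
  with `C Cᵀ = (n−1) I`) of order `n ≡ 2 (mod 4)` with `3 ∣ n − 1`, `9 ∤ n − 1` (`n = 22, 34, 58, 70, 94, 106, …`).
* **`no_conferenceGraph_three`**, **`no_conferenceGraph_21`** — no conference graph `srg(4μ+1, 2μ, μ−1, μ)` with
  `3 ∥ 4μ + 1`; in particular NO `srg(21, 10, 4, 5)` (bordering its Seidel matrix, `conference_of_conferenceGraph`).
PRINT STATUS: the conclusions are classical — a symmetric conference matrix of order `n ≡ 2 (mod 4)` exists only if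
`n − 1` is a sum of two squares (Belevitch 1950; Raghavarao 1960; van Lint–Seidel 1966, *Indag. Math.* 28), and
`srg(21,10,4,5)` is listed as nonexistent in Brouwer's tables; the 3-adic/coding proof route formalised here is ours
(REPLICATION of a known nonexistence, our proof).  No `sorry`, no new definitions.
-/

namespace Summit.Ventures.DiscreteObjects.Hadamard

open Matrix Finset

/-! ## §1 A block determinant -/

section blocks
variable {K : Type*} [CommRing K] {m : Type*} [Fintype m] [DecidableEq m]

/-- `det [[0, I], [I, 0]] = (-1)^{|m|}` (the swap of the two halves). -/
theorem det_fromBlocks_zero_one_one_zero :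
    (fromBlocks (0 : Matrix m m K) (1 : Matrix m m K) (1 : Matrix m m K) (0 : Matrix m m K)).det =
      (-1) ^ Fintype.card m := by
  have h1 : fromBlocks (1 : Matrix m m K) (1 : Matrix m m K) (0 : Matrix m m K) (1 : Matrix m m K) *
      fromBlocks (0 : Matrix m m K) (1 : Matrix m m K) (1 : Matrix m m K) (0 : Matrix m m K) =
      fromBlocks (1 : Matrix m m K) (1 : Matrix m m K) (1 : Matrix m m K) (0 : Matrix m m K) := by
    rw [fromBlocks_multiply]; simp
  have h2 : (fromBlocks (1 : Matrix m m K) (1 : Matrix m m K) (0 : Matrix m m K) (1 : Matrix m m K)).det = 1 := by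
    rw [det_fromBlocks_zero₂₁, det_one, mul_one]
  have h3 : (fromBlocks (1 : Matrix m m K) (1 : Matrix m m K) (1 : Matrix m m K) (0 : Matrix m m K)).det =
      (-1) ^ Fintype.card m := by
    rw [det_fromBlocks_one₁₁, Matrix.one_mul, zero_sub, det_neg, det_one, mul_one]
  have h := congrArg Matrix.det h1
  rw [det_mul, h2, one_mul, h3] at h
  exact h

/-- **`det [[0, B], [C, D]] = (-1)^{|m|} · det B · det C`** for square blocks (`[[0,B],[C,D]] = [[B,0],[D,C]]·[[0,I],[I,0]]`). -/
theorem det_fromBlocks_zero₁₁_sq (B C D : Matrix m m K) :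
    (fromBlocks (0 : Matrix m m K) B C D).det = (-1) ^ Fintype.card m * (B.det * C.det) := by
  have h1 : fromBlocks (0 : Matrix m m K) B C D =
      fromBlocks B 0 D C * fromBlocks (0 : Matrix m m K) (1 : Matrix m m K) (1 : Matrix m m K) (0 : Matrix m m K) := by
    rw [fromBlocks_multiply]; simp
  rw [h1, det_mul, det_fromBlocks_zero₁₂, det_fromBlocks_zero_one_one_zero]; ring

end blocks

/-! ## §2 No Lagrangian (maximal totally isotropic) subspace of odd dimension over `𝔽₃` -/

section isotropic

/-- in `𝔽₃` a nonzero square is never minus a square -/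
theorem zmod3_sq_ne_neg_sq : ∀ a d : ZMod 3, a ≠ 0 → a * a ≠ -(d * d) := by decide

/-- **No totally isotropic subspace of dimension `m` in `𝔽₃^{2m}` (standard dot product) when `m` is odd.** -/
theorem no_lagrangian_odd_zmod3 {ι : Type*} [Fintype ι] [DecidableEq ι]
    (W : Submodule (ZMod 3) (ι → ZMod 3)) (hW : ∀ u ∈ W, ∀ u' ∈ W, u ⬝ᵥ u' = 0)
    {m : ℕ} (hm : Odd m) (hWm : Module.finrank (ZMod 3) W = m) (hι : Fintype.card ι = 2 * m) : False := by
  classical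
  haveI : Fact (Nat.Prime 3) := ⟨by norm_num⟩
  obtain ⟨U, hWU⟩ := W.exists_isCompl
  have hUm : Module.finrank (ZMod 3) U = m := by
    have h := Submodule.finrank_add_eq_of_isCompl hWU
    rw [hWm, Module.finrank_fintype_fun_eq_card, hι] at h
    omega
  let bW : Module.Basis (Fin m) (ZMod 3) W := Module.finBasisOfFinrankEq (ZMod 3) W hWm
  let bU : Module.Basis (Fin m) (ZMod 3) U := Module.finBasisOfFinrankEq (ZMod 3) U hUm
  let e : (W × U) ≃ₗ[ZMod 3] (ι → ZMod 3) := Submodule.prodEquivOfIsCompl W U hWU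
  let b : Module.Basis (Fin m ⊕ Fin m) (ZMod 3) (ι → ZMod 3) := (bW.prod bU).map e
  have hb_inl : ∀ i, b (Sum.inl i) = (bW i : ι → ZMod 3) := by
    intro i
    simp [b, e, bW]
  -- reindex `ι` by `Fin m ⊕ Fin m`
  have hcard : Fintype.card ι = Fintype.card (Fin m ⊕ Fin m) := by
    rw [Fintype.card_sum, Fintype.card_fin, hι, two_mul]
  let eι : ι ≃ Fin m ⊕ Fin m := Fintype.equivOfCardEq hcard
  let s : Module.Basis (Fin m ⊕ Fin m) (ZMod 3) (ι → ZMod 3) := (Pi.basisFun (ZMod 3) ι).reindex eι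
  set M : Matrix (Fin m ⊕ Fin m) (Fin m ⊕ Fin m) (ZMod 3) := s.toMatrix b with hM_def
  have hM_apply : ∀ i j, M i j = b j (eι.symm i) := by
    intro i j
    rw [hM_def, Module.Basis.toMatrix_apply, Module.Basis.repr_reindex_apply, Pi.basisFun_repr]
  have hMunit : IsUnit M.det := by
    have h := congrArg Matrix.det (s.toMatrix_mul_toMatrix_flip b)
    rw [det_mul, det_one] at h
    exact IsUnit.of_mul_eq_one _ h
  set G : Matrix (Fin m ⊕ Fin m) (Fin m ⊕ Fin m) (ZMod 3) := Matrix.of fun a c => b a ⬝ᵥ b c with hG_def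
  have hMG : Mᵀ * M = G := by
    ext a c
    rw [Matrix.mul_apply, hG_def, Matrix.of_apply, dotProduct]
    simp only [Matrix.transpose_apply, hM_apply]
    exact Equiv.sum_comp eι.symm (fun x => b a x * b c x)
  have hGsymm : ∀ a c, G c a = G a c := fun a c => by
    rw [hG_def, Matrix.of_apply, Matrix.of_apply, dotProduct_comm]
  have hG11 : G.toBlocks₁₁ = 0 := by
    ext i j
    rw [Matrix.toBlocks₁₁, Matrix.of_apply, hG_def, Matrix.of_apply, hb_inl, hb_inl, Matrix.zero_apply]
    exact hW _ (bW i).2 _ (bW j).2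
  have hG21 : G.toBlocks₂₁ = (G.toBlocks₁₂)ᵀ := by
    ext i j
    simp only [Matrix.toBlocks₂₁, Matrix.toBlocks₁₂, Matrix.transpose_apply, Matrix.of_apply]
    exact hGsymm _ _
  have hdetG : G.det = -(G.toBlocks₁₂.det * G.toBlocks₁₂.det) := by
    conv_lhs => rw [← Matrix.fromBlocks_toBlocks G, hG11, hG21]
    rw [det_fromBlocks_zero₁₁_sq, det_transpose, Fintype.card_fin, hm.neg_one_pow]; ring
  have hdetG' : G.det = M.det * M.det := by rw [← hMG, det_mul, det_transpose]
  exact zmod3_sq_ne_neg_sq M.det (G.toBlocks₁₂.det) hMunit.ne_zero (by rw [← hdetG', hdetG])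

end isotropic

/-! ## §3 The 3-adic obstruction for symmetric integer matrices with `C² = c·I` -/

section threeAdic
variable {ι : Type*} [Fintype ι] [DecidableEq ι]

/-- **The 3-adic obstruction.**  A symmetric integer matrix `C` on `n ≡ 2 (mod 4)` indices cannot satisfy `C * C = c • 1`
with `3 ∣ c` and `9 ∤ c`.  (Over `ℚ` this says: `c·I_n ≅ I_n` with `n ≡ 2 (mod 4)` forces `v₃(c)` even — the `3`-adic
case of the two-squares condition; here proved through `𝔽₃`: `C mod 3` has `ker = im`, its column space is an
`n/2`-dimensional totally isotropic subspace of `𝔽₃ⁿ`, impossible for `n/2` odd by `no_lagrangian_odd_zmod3`.) -/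
theorem no_symm_mul_self_eq_smul_three (C : Matrix ι ι ℤ) (hsymm : Cᵀ = C) {c : ℤ}
    (hC : C * C = c • (1 : Matrix ι ι ℤ)) (h3 : (3 : ℤ) ∣ c) (h9 : ¬ (9 : ℤ) ∣ c)
    (hι : Fintype.card ι % 4 = 2) : False := by
  classical
  haveI : Fact (Nat.Prime 3) := ⟨by norm_num⟩
  obtain ⟨c', rfl⟩ := h3
  have hc' : ¬ (3 : ℤ) ∣ c' := fun ⟨d, hd⟩ => h9 ⟨d, by rw [hd]; ring⟩
  let φ : ℤ →+* ZMod 3 := Int.castRingHom (ZMod 3)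
  set Cb : Matrix ι ι (ZMod 3) := C.map φ with hCb_def
  have hφ3 : ∀ z : ℤ, φ (3 * z) = 0 := fun z => by
    show ((3 * z : ℤ) : ZMod 3) = 0
    rw [ZMod.intCast_zmod_eq_zero_iff_dvd]
    exact ⟨z, by push_cast; ring⟩
  have hCbT : Cbᵀ = Cb := by rw [hCb_def, ← Matrix.transpose_map, hsymm]
  have hCb2 : Cb * Cb = 0 := by
    rw [hCb_def, ← Matrix.map_mul, hC]
    ext i j
    rw [Matrix.map_apply, Matrix.smul_apply, Matrix.zero_apply, smul_eq_mul, map_mul, hφ3, zero_mul]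
  let f : (ι → ZMod 3) →ₗ[ZMod 3] (ι → ZMod 3) := Matrix.mulVecLin Cb
  have hf : ∀ v, f v = Cb *ᵥ v := fun v => rfl
  -- `im ⊆ ker`
  have h_rk : LinearMap.range f ≤ LinearMap.ker f := by
    rintro _ ⟨a, rfl⟩
    rw [LinearMap.mem_ker, hf, hf, Matrix.mulVec_mulVec, hCb2, Matrix.zero_mulVec]
  -- `ker ⊆ im` (integrality: `9 ∤ c`)
  have h_kr : LinearMap.ker f ≤ LinearMap.range f := by
    intro vb hvb
    rw [LinearMap.mem_ker, hf] at hvb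
    let v : ι → ℤ := fun i => ((vb i).val : ℤ)
    have hv : (φ ∘ v) = vb := by
      funext i
      show (((vb i).val : ℤ) : ZMod 3) = vb i
      rw [Int.cast_natCast, ZMod.natCast_zmod_val]
    have hdvd : ∀ i, ∃ wi : ℤ, (C *ᵥ v) i = 3 * wi := by
      intro i
      have h := RingHom.map_mulVec φ C v i
      rw [hv, ← hCb_def, hvb, Pi.zero_apply] at h
      have h' : ((3 : ℕ) : ℤ) ∣ (C *ᵥ v) i := (ZMod.intCast_zmod_eq_zero_iff_dvd _ 3).mp h
      exact_mod_cast h'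
    choose w hw using hdvd
    have hCw : C *ᵥ w = fun i => c' * v i := by
      have h1 : C *ᵥ (C *ᵥ v) = fun i => 3 * c' * v i := by
        rw [Matrix.mulVec_mulVec, hC, Matrix.smul_mulVec, Matrix.one_mulVec]
        funext i; rw [Pi.smul_apply, smul_eq_mul]
      have h2 : C *ᵥ v = (3 : ℤ) • w := by
        funext i; rw [hw i, Pi.smul_apply, smul_eq_mul]
      rw [h2, Matrix.mulVec_smul] at h1
      funext i
      have h := congrFun h1 i
      rw [Pi.smul_apply, smul_eq_mul, mul_assoc] at h
      exact mul_left_cancel₀ (by norm_num : (3 : ℤ) ≠ 0) h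
    have hc'K : φ c' ≠ 0 := by
      show ((c' : ℤ) : ZMod 3) ≠ 0
      rw [Ne, ZMod.intCast_zmod_eq_zero_iff_dvd]
      exact_mod_cast hc'
    refine ⟨(φ c')⁻¹ • (φ ∘ w), ?_⟩
    rw [hf, Matrix.mulVec_smul]
    have h4 : Cb *ᵥ (φ ∘ w) = φ c' • vb := by
      funext i
      have h := RingHom.map_mulVec φ C w i
      rw [← hCb_def] at h
      rw [← h, hCw, ← hv, Pi.smul_apply, smul_eq_mul, Function.comp_apply, map_mul]
    rw [h4, smul_smul, inv_mul_cancel₀ hc'K, one_smul]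
  have hker : LinearMap.ker f = LinearMap.range f := le_antisymm h_kr h_rk
  -- dimension count: `rank = n / 2`, odd
  have hdim := LinearMap.finrank_range_add_finrank_ker f
  rw [hker, Module.finrank_fintype_fun_eq_card] at hdim
  set m := Module.finrank (ZMod 3) (LinearMap.range f) with hm_def
  have hιm : Fintype.card ι = 2 * m := by omega
  have hm_odd : Odd m := by rw [Nat.odd_iff]; omega
  -- the column space is totally isotropic
  have hW : ∀ u ∈ LinearMap.range f, ∀ u' ∈ LinearMap.range f, u ⬝ᵥ u' = 0 := by
    rintro _ ⟨a, rfl⟩ _ ⟨a', rfl⟩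
    rw [hf, hf, ← Matrix.vecMul_transpose, hCbT, ← Matrix.dotProduct_mulVec, Matrix.mulVec_mulVec, hCb2,
      Matrix.zero_mulVec, dotProduct_zero]
  exact no_lagrangian_odd_zmod3 (LinearMap.range f) hW hm_odd hm_def.symm hιm

/-- **No symmetric conference matrix of order `n ≡ 2 (mod 4)` with `3 ∥ n − 1`** (`n = 22, 34, 58, 70, 94, 106, …`):
a symmetric integer `C` with `C Cᵀ = (n − 1)·I` (conference matrices have this with `0` diagonal and `±1` elsewhere). -/
theorem no_symm_conference_three (C : Matrix ι ι ℤ) (hsym : ∀ i j, C j i = C i j)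
    (hC : C * Cᵀ = ((Fintype.card ι : ℤ) - 1) • (1 : Matrix ι ι ℤ))
    (h3 : 3 ∣ Fintype.card ι - 1) (h9 : ¬ 9 ∣ Fintype.card ι - 1) (hn : Fintype.card ι % 4 = 2) : False := by
  have hT : Cᵀ = C := by ext i j; exact hsym i j
  rw [hT] at hC
  refine no_symm_mul_self_eq_smul_three C hT hC ?_ ?_ hn
  · obtain ⟨k, hk⟩ := h3
    exact ⟨k, by omega⟩
  · rintro ⟨d, hd⟩
    apply h9
    omega

end threeAdic

/-! ## §4 No conference graph on `4μ + 1` vertices with `3 ∥ 4μ + 1`; no `srg(21,10,4,5)` -/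

section graphs
variable {V : Type*} [Fintype V] [DecidableEq V]

/-- **No conference graph `srg(4μ+1, 2μ, μ−1, μ)` when `3 ∣ 4μ+1` and `9 ∤ 4μ+1`** (`v = 21, 33, 57, 69, 93, 105, …`):
the bordered Seidel matrix (`conference_of_conferenceGraph`) would be a symmetric conference matrix of order `4μ + 2`. -/
theorem no_conferenceGraph_three (A : Matrix V V ℤ) (h01 : ∀ x y, A x y = 0 ∨ A x y = 1)
    (hsymm : ∀ x y, A y x = A x y) (hdiag : ∀ x, A x x = 0) (μ : ℤ) (hv : (Fintype.card V : ℤ) = 4 * μ + 1)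
    (hk : ∀ x, ∑ y, A x y = 2 * μ) (hsrg : ∀ x y, ∑ z, A x z * A z y = μ * (1 + (if x = y then 1 else 0)) - A x y)
    (h3 : (3 : ℤ) ∣ 4 * μ + 1) (h9 : ¬ (9 : ℤ) ∣ 4 * μ + 1) : False := by
  classical
  obtain ⟨-, -, hsym, hCC⟩ := conference_of_conferenceGraph A h01 hsymm hdiag μ hv hk hsrg
  set C : Matrix (Option V) (Option V) ℤ := Matrix.of fun p q => Option.elim p (Option.elim q 0 (fun _ => 1))
      (fun x => Option.elim q 1 (fun y => 1 - (if x = y then 1 else 0) - 2 * A x y)) with hC_def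
  have hT : Cᵀ = C := by ext i j; exact hsym i j
  have hcard : (Fintype.card (Option V) : ℤ) - 1 = 4 * μ + 1 := by
    rw [Fintype.card_option]; push_cast; linarith
  rw [hcard, hT] at hCC
  refine no_symm_mul_self_eq_smul_three C hT hCC h3 h9 ?_
  rw [Fintype.card_option]
  omega

/-- **There is no `srg(21, 10, 4, 5)`** (conference graph on `21` vertices; `21 = 3·7` is not a sum of two squares). -/
theorem no_conferenceGraph_21 (hV : Fintype.card V = 21) (A : Matrix V V ℤ) (h01 : ∀ x y, A x y = 0 ∨ A x y = 1)
    (hsymm : ∀ x y, A y x = A x y) (hdiag : ∀ x, A x x = 0) (hk : ∀ x, ∑ y, A x y = 10)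
    (hsrg : ∀ x y, ∑ z, A x z * A z y = 5 * (1 + (if x = y then 1 else 0)) - A x y) : False :=
  no_conferenceGraph_three A h01 hsymm hdiag 5 (by rw [hV]; norm_num) (fun x => by rw [hk x]; norm_num) hsrg
    ⟨7, by norm_num⟩ (by norm_num)

end graphs

end Summit.Ventures.DiscreteObjects.Hadamard
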